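import Mathlib
import HarnessLib.Audit
import Summits.PneNP.PneNP.Theorems.PstarFreshErase

/-!
# Chords must be read, and linear reads of a chord private are rigid (ROUND-24, O1 at exact tightness; `TerminalPeelable`)

FRONTIER range-avoidance ladder, rung F-N3, ROUND 24 (cell `pnp-ideate`, planner memo `r24/CORE-BOUND-NOTES.md` §7 G1 / §11 (N3) / §14.7,
prover-2 memo `g19/O1-CHORD-READ.md`; typed target `PstarCoreBoundTargets.TerminalPeelable` (p646951); restricted-model proof complexity — nothing
here bears on `P` versus `NP`).

The two ASSUMPTION-FREE steps of the chord-read lemma (memo §2), at the instance level, for a terminal core `J₀` (`Terminal`: (T3) no solution of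
`J₀ ∧ Γ₁ ∧ Γ₂`, (M0) every `J₀ ∖ f ∧ Γ₁ ∧ Γ₂` solvable) and a CHORD `c ∈ J₀` (both AND variables `p = vars c 2`, `q = vars c 3` private):

* `solves_update_of_chord` — flipping the private `p` at a solution of `J₀` with `x_q = 0` gives a solution of `J₀` (the involution);
* `exists_linear_read_of_chord` — **REPAIR LEMMA**: if no monomial of `Γ₁, Γ₂` touches `p, q`, then `p` or `q` is read LINEARLY (lies in
  `C₁ ∪ C₂`): otherwise the (M0) witness for `c`, lifted by `PstarFreshErase.lift` (`p := 1`, `q := κ`), solves everything, against (T3);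
* `gval₂_ne_of_read₁` / `gval₁_ne_of_read₂` — **INVOLUTION LEMMA, direction `(1,0)` / `(0,1)`**: if `p` is untouched by monomials, read linearly
  by `Γ₁` and not by `Γ₂`, then `Γ₂` is violated at EVERY solution of `J₀` with `x_q = 0` (and symmetrically);
* `gval_iff_of_read_both` — direction `(1,1)`: if both read `p` linearly, then at every solution of `J₀` with `x_q = 0` exactly one of `Γ₁, Γ₂` holds.

No Assumption A, no peelability: everything is local to the chord `c`.  The third step of the memo (genericity of the feature map on
`Sol(J₀) ∩ {x_q = 0}` etc.) is certified numerically for the 1800 tight `k = 12` structures (kit j314774) and is not formalised here.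
-/

set_option linter.dupNamespace false -- `Summit.PneNP.PneNP.…`: summit = sub-problem name (D-0017 single-conjunct layout)

open Finset Literature.Computability.Complexity
open Summit.PneNP.PneNP.Theorems.PstarFibrePolys (bit bit_injective)
open Summit.PneNP.PneNP.Theorems.PstarSALevel (varSet bdry)
open Summit.PneNP.PneNP.Theorems.PstarGapPeeling (eval_update_of_not_mem not_mem_varSet_of_private)
open Summit.PneNP.PneNP.Theorems.PstarCentreFree (vars_mem_varSet)
open Summit.PneNP.PneNP.Theorems.PstarGapOneAll (gval)
open Summit.PneNP.PneNP.Theorems.PstarChordRepair (IsChord)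
open Summit.PneNP.PneNP.Theorems.PstarCoreBoundTargets (Terminal)
open Summit.PneNP.PneNP.Theorems.PstarFreshErase (bit_gval_update_lin bit_eval_e slots_ne lift lift_p eval_lift)

namespace Summit.PneNP.PneNP.Theorems.PstarChordReads

variable {n m : ℕ}

/-- `x + x = 0` in `𝔽₂`. -/
private theorem add_self_zmod2 (x : ZMod 2) : x + x = 0 := by
  revert x; decide

section Flip

variable {I : LocalMap 4 n m} {J₀ : Finset (Fin m)} {c : Fin m} {y : Fin m → Bool}

/-- Updating a private of `c` does not disturb the other outputs of the core. -/
theorem eval_update_of_private (hc : c ∈ J₀) {j : Fin m} (hj : j ∈ J₀) (hjc : j ≠ c) {v : Fin n} (hv : v ∈ bdry I J₀)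
    (hvc : v ∈ varSet I c) (x : Fin n → Bool) (b : Bool) : I.eval (Function.update x v b) j = I.eval x j :=
  eval_update_of_not_mem I j x (not_mem_varSet_of_private I hc hj hjc hv hvc) b

/-- With `x_q = 0` the equation of `c` does not see `p`. -/
theorem eval_update_two_of_three (hI : I.IsPure xorAndPred) (x : Fin n → Bool) (hq : x (I.vars c 3) = false) (b : Bool) :
    I.eval (Function.update x (I.vars c 2) b) c = I.eval x c := by
  have hpp : (I.vars c 2 = I.vars c 2 ∧ I.vars c 3 = I.vars c 3) ∨ (I.vars c 2 = I.vars c 3 ∧ I.vars c 3 = I.vars c 2) := Or.inl ⟨rfl, rfl⟩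
  obtain ⟨-, h0p, -, h1p, -⟩ := slots_ne hI hpp
  have h23 : I.vars c 3 ≠ I.vars c 2 := fun h => absurd (hI.2 c h) (by decide)
  apply bit_injective
  rw [bit_eval_e hI hpp, bit_eval_e hI hpp, Function.update_of_ne h0p, Function.update_of_ne h1p, Function.update_of_ne h23, hq]
  simp [bit]

/-- **The involution.**  Flipping the private `p = vars c 2` of a chord at a solution of the core with `x_q = 0` gives a solution of the core. -/
theorem solves_update_of_chord (hI : I.IsPure xorAndPred) (hc : c ∈ J₀) (hch : IsChord I J₀ c) {x : Fin n → Bool}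
    (hx : ∀ j ∈ J₀, I.eval x j = y j) (hq : x (I.vars c 3) = false) (b : Bool) :
    ∀ j ∈ J₀, I.eval (Function.update x (I.vars c 2) b) j = y j := by
  intro j hj
  by_cases hjc : j = c
  · subst hjc; rw [eval_update_two_of_three hI x hq b, hx j hj]
  · rw [eval_update_of_private hc hj hjc hch.1 (vars_mem_varSet I c 2) x b, hx j hj]

/-- Flipping a linear-only variable moves a G-constraint by its linear coefficient (Boolean form). -/
theorem gval_update_not (I : LocalMap 4 n m) (C : Finset (Fin n)) {G : Finset (Fin m)} (x : Fin n → Bool) {v : Fin n}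
    (hG : ∀ g ∈ G, I.vars g 2 ≠ v ∧ I.vars g 3 ≠ v) :
    gval I C G (Function.update x v (!x v)) = (if v ∈ C then !gval I C G x else gval I C G x) := by
  apply bit_injective
  rw [bit_gval_update_lin I C x hG]
  split_ifs with h
  · cases x v <;> cases gval I C G x <;> decide
  · rw [add_zero]

end Flip

section Terminal

variable {I : LocalMap 4 n m} {r : ℕ} {y : Fin m → Bool} {J₀ : Finset (Fin m)} {w₁ w₂ : Finset (Fin n) × Finset (Fin m) × Bool} {c : Fin m}

/-- **REPAIR LEMMA.**  In a terminal core, a chord whose two privates are touched by no monomial of the constraints has a private in a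
linear part: otherwise lifting the (M0) witness of `c` (`p := 1`, `q := κ`) solves `J₀ ∧ Γ₁ ∧ Γ₂`. -/
theorem exists_linear_read_of_chord (hI : I.IsPure xorAndPred) (ht : Terminal I r y J₀ w₁ w₂) (hc : c ∈ J₀) (hch : IsChord I J₀ c)
    (hmono : ∀ g ∈ w₁.2.1 ∪ w₂.2.1, (I.vars g 2 ≠ I.vars c 2 ∧ I.vars g 3 ≠ I.vars c 2) ∧ (I.vars g 2 ≠ I.vars c 3 ∧ I.vars g 3 ≠ I.vars c 3)) :
    I.vars c 2 ∈ w₁.1 ∪ w₂.1 ∨ I.vars c 3 ∈ w₁.1 ∪ w₂.1 := by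
  by_contra h
  push Not at h
  obtain ⟨h2, h3⟩ := h
  obtain ⟨x, hx, hg₁, hg₂⟩ := ht.2.2.2.2.2.2.2 c hc
  have hpp : (I.vars c 2 = I.vars c 2 ∧ I.vars c 3 = I.vars c 3) ∨ (I.vars c 2 = I.vars c 3 ∧ I.vars c 3 = I.vars c 2) := Or.inl ⟨rfl, rfl⟩
  have hne : I.vars c 2 ≠ I.vars c 3 := fun h => absurd (hI.2 c h) (by decide)
  set x' := lift I y c (I.vars c 2) (I.vars c 3) x with hx'
  -- `x'` solves the whole core
  have hsol : ∀ j ∈ J₀, I.eval x' j = y j := by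
    intro j hj
    by_cases hjc : j = c
    · subst hjc; exact eval_lift hI hpp hne y x
    · rw [hx']
      unfold lift
      rw [eval_update_of_private hc hj hjc hch.2 (vars_mem_varSet I c 3),
        eval_update_of_private hc hj hjc hch.1 (vars_mem_varSet I c 2)]
      exact hx j (mem_erase.2 ⟨hjc, hj⟩)
  -- and does not move the constraints
  have hgv : ∀ (w : Finset (Fin n) × Finset (Fin m) × Bool), (∀ g ∈ w.2.1, (I.vars g 2 ≠ I.vars c 2 ∧ I.vars g 3 ≠ I.vars c 2) ∧
      (I.vars g 2 ≠ I.vars c 3 ∧ I.vars g 3 ≠ I.vars c 3)) → I.vars c 2 ∉ w.1 → I.vars c 3 ∉ w.1 →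
      gval I w.1 w.2.1 x' = gval I w.1 w.2.1 x := by
    intro w hw hp hq
    apply bit_injective
    rw [hx']
    unfold lift
    rw [bit_gval_update_lin I w.1 _ (fun g hg => (hw g hg).2), if_neg hq, add_zero,
      bit_gval_update_lin I w.1 _ (fun g hg => (hw g hg).1), if_neg hp, add_zero]
  refine ht.2.2.2.2.2.2.1 ⟨x', hsol, ?_, ?_⟩
  · rw [hgv w₁ (fun g hg => hmono g (mem_union_left _ hg)) (fun h => h2 (mem_union_left _ h)) (fun h => h3 (mem_union_left _ h))]
    exact hg₁
  · rw [hgv w₂ (fun g hg => hmono g (mem_union_right _ hg)) (fun h => h2 (mem_union_right _ h)) (fun h => h3 (mem_union_right _ h))]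
    exact hg₂

/-- (T3): no solution of the core satisfies both constraints. -/
private theorem not_both (ht : Terminal I r y J₀ w₁ w₂) {x : Fin n → Bool} (hx : ∀ j ∈ J₀, I.eval x j = y j)
    (h₁ : gval I w₁.1 w₁.2.1 x = w₁.2.2) (h₂ : gval I w₂.1 w₂.2.1 x = w₂.2.2) : False :=
  ht.2.2.2.2.2.2.1 ⟨x, hx, h₁, h₂⟩

/-- **INVOLUTION LEMMA, direction `(1,0)`.**  If the private `p = vars c 2` of a chord is touched by no monomial, read linearly by `Γ₁` and not by
`Γ₂`, then `Γ₂` FAILS at every solution of the core with `x_q = 0`. -/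
theorem gval₂_ne_of_read₁ (hI : I.IsPure xorAndPred) (ht : Terminal I r y J₀ w₁ w₂) (hc : c ∈ J₀) (hch : IsChord I J₀ c)
    (hmono : ∀ g ∈ w₁.2.1 ∪ w₂.2.1, I.vars g 2 ≠ I.vars c 2 ∧ I.vars g 3 ≠ I.vars c 2) (hp₁ : I.vars c 2 ∈ w₁.1) (hp₂ : I.vars c 2 ∉ w₂.1)
    {x : Fin n → Bool} (hx : ∀ j ∈ J₀, I.eval x j = y j) (hq : x (I.vars c 3) = false) : gval I w₂.1 w₂.2.1 x ≠ w₂.2.2 := by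
  intro h₂
  have hx' := solves_update_of_chord hI hc hch hx hq (!x (I.vars c 2))
  have h₁' := gval_update_not I w₁.1 x (fun g hg => hmono g (mem_union_left _ hg))
  have h₂' := gval_update_not I w₂.1 x (fun g hg => hmono g (mem_union_right _ hg))
  rw [if_pos hp₁] at h₁'
  rw [if_neg hp₂, h₂] at h₂'
  by_cases h₁ : gval I w₁.1 w₁.2.1 x = w₁.2.2
  · exact not_both ht hx h₁ h₂
  · refine not_both ht hx' ?_ h₂'
    rw [h₁']
    revert h₁
    cases gval I w₁.1 w₁.2.1 x <;> cases w₁.2.2 <;> decide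

/-- **INVOLUTION LEMMA, direction `(0,1)`** (the mirror image). -/
theorem gval₁_ne_of_read₂ (hI : I.IsPure xorAndPred) (ht : Terminal I r y J₀ w₁ w₂) (hc : c ∈ J₀) (hch : IsChord I J₀ c)
    (hmono : ∀ g ∈ w₁.2.1 ∪ w₂.2.1, I.vars g 2 ≠ I.vars c 2 ∧ I.vars g 3 ≠ I.vars c 2) (hp₁ : I.vars c 2 ∉ w₁.1) (hp₂ : I.vars c 2 ∈ w₂.1)
    {x : Fin n → Bool} (hx : ∀ j ∈ J₀, I.eval x j = y j) (hq : x (I.vars c 3) = false) : gval I w₁.1 w₁.2.1 x ≠ w₁.2.2 := by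
  intro h₁
  have hx' := solves_update_of_chord hI hc hch hx hq (!x (I.vars c 2))
  have h₁' := gval_update_not I w₁.1 x (fun g hg => hmono g (mem_union_left _ hg))
  have h₂' := gval_update_not I w₂.1 x (fun g hg => hmono g (mem_union_right _ hg))
  rw [if_neg hp₁, h₁] at h₁'
  rw [if_pos hp₂] at h₂'
  by_cases h₂ : gval I w₂.1 w₂.2.1 x = w₂.2.2
  · exact not_both ht hx h₁ h₂
  · refine not_both ht hx' h₁' ?_
    rw [h₂']
    revert h₂
    cases gval I w₂.1 w₂.2.1 x <;> cases w₂.2.2 <;> decide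

/-- **INVOLUTION LEMMA, direction `(1,1)`.**  If both constraints read `p` linearly (and no monomial touches it), then at every solution of the
core with `x_q = 0` EXACTLY ONE of `Γ₁, Γ₂` holds. -/
theorem gval_iff_of_read_both (hI : I.IsPure xorAndPred) (ht : Terminal I r y J₀ w₁ w₂) (hc : c ∈ J₀) (hch : IsChord I J₀ c)
    (hmono : ∀ g ∈ w₁.2.1 ∪ w₂.2.1, I.vars g 2 ≠ I.vars c 2 ∧ I.vars g 3 ≠ I.vars c 2) (hp₁ : I.vars c 2 ∈ w₁.1) (hp₂ : I.vars c 2 ∈ w₂.1)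
    {x : Fin n → Bool} (hx : ∀ j ∈ J₀, I.eval x j = y j) (hq : x (I.vars c 3) = false) :
    (gval I w₁.1 w₁.2.1 x = w₁.2.2 ↔ gval I w₂.1 w₂.2.1 x ≠ w₂.2.2) := by
  have hx' := solves_update_of_chord hI hc hch hx hq (!x (I.vars c 2))
  have h₁' := gval_update_not I w₁.1 x (fun g hg => hmono g (mem_union_left _ hg))
  have h₂' := gval_update_not I w₂.1 x (fun g hg => hmono g (mem_union_right _ hg))
  rw [if_pos hp₁] at h₁'
  rw [if_pos hp₂] at h₂'
  have hA := fun (a : gval I w₁.1 w₁.2.1 x = w₁.2.2) (b : gval I w₂.1 w₂.2.1 x = w₂.2.2) => not_both ht hx a b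
  have hB := fun (a : gval I w₁.1 w₁.2.1 (Function.update x (I.vars c 2) (!x (I.vars c 2))) = w₁.2.2)
    (b : gval I w₂.1 w₂.2.1 (Function.update x (I.vars c 2) (!x (I.vars c 2))) = w₂.2.2) => not_both ht hx' a b
  rw [h₁', h₂'] at hB
  revert hA hB
  cases gval I w₁.1 w₁.2.1 x <;> cases w₁.2.2 <;> cases gval I w₂.1 w₂.2.1 x <;> cases w₂.2.2 <;> decide

end Terminal

end Summit.PneNP.PneNP.Theorems.PstarChordReads
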